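import Summits.Langlands.Langlands.Theses.MinimalLevelDescent

/-!
# Glue of the generation-2 resplit of `LevelPrimeDescent` (route MinimalLevelDescent, rev 3)

Closes the glue item `stmt-Langlands-31278` of `route-Langlands-MinimalLevelDescent`:
`LevelPrimeDescent_of_resplit : WeightMove → LevelMove → ResidualInertiaDescent →
LevelOneCrystallineDescent → LevelPrimeDescent` (lens-4 node `LevelOneNormalForm`, decomp-langlands
2026-08-30; the node proof was certified against a mock render whose W and L are `Iff.rfl`-equal to the
tree decls).  Pure logic — W reduces height `(k, ℓ)` to the crystalline case; a crystalline `ρ` is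
lift-minimal or not (L takes the non-minimal ones); a lift-minimal one is ramified at some `w ∤ ℓ` (K,
fed with L's conclusion at the same height) or has level one, and then `k = 0` is Z while `k ≥ 1` is
D's own induction hypothesis at the smaller height `(0, ℓ)`.  No definitions, no new mathematics.
-/

set_option linter.dupNamespace false -- project-wide option; `Summit.Langlands.Langlands` is the mandated namespace

namespace Summit.Langlands.Langlands.Theorems

open Summit.Langlands.Langlands.Theses in
/-- Glue of the resplit: W → L → K → Z → D.  Pure logic: W reduces height (k, ℓ) to the crystalline case; a crystalline ρ is
lift-minimal or not (L takes the non-minimal ones); a lift-minimal one is ramified at some w ∤ ℓ — K, whose level-move hypothesis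
at the same height is L's conclusion — or has level one, and then k = 0 is Z (whose IH is D's IH at (0, ℓ), level ≤ 0 ⟺ unramified
away from ℓ′) while k ≥ 1 is D's IH at the smaller height (0, ℓ). -/
theorem LevelPrimeDescent_of_resplit_proof :
    Summit.Langlands.Langlands.Theses.MinimalLevelDescent.LevelPrimeDescent_of_resplit := by
  intro hWM hLM hK hZ hW hL k ℓ _ h02 hIH
  refine hWM hW hL k ℓ h02 hIH ?_
  intro K _ _ n hcpt hn ι ρ hirr hgeo hcrys hlev
  -- L's conclusion at THIS height (k, ℓ): Serre_w on the level-move class, every number field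
  have hN := hLM hW hL k ℓ h02 hIH
  by_cases hmin : ∀ w : IsDedekindDomain.HeightOneSpectrum (NumberField.RingOfIntegers K),
      ((ℓ : ℕ) : NumberField.RingOfIntegers K) ∉ w.asIdeal → ¬ ρ.IsUnramifiedAt w →
        ∀ τ : Field.absoluteGaloisGroup K →* Matrix.GeneralLinearGroup (Fin n)
            (Literature.NumberTheory.GaloisRepresentations.padicAlgClResidueField ℓ),
          ρ.IsResidualRepOf
              (RingHom.id (Literature.NumberTheory.GaloisRepresentations.padicAlgClResidueField ℓ)) τ →
            ¬ (∀ 𝔓 ∈ w.primesAbove, ∀ σ ∈ 𝔓.inertia (Field.absoluteGaloisGroup K), τ σ = 1)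
  · -- lift-minimal: ramified somewhere away from ℓ (K) or level one (Z at k = 0, D's IH at (0, ℓ) for k ≥ 1)
    by_cases hram : ∃ w : IsDedekindDomain.HeightOneSpectrum (NumberField.RingOfIntegers K),
        ((ℓ : ℕ) : NumberField.RingOfIntegers K) ∉ w.asIdeal ∧ ¬ ρ.IsUnramifiedAt w
    · exact hK hW hL k ℓ h02 hIH hN K n hcpt hn ι ρ hirr hgeo hcrys hlev hmin hram
    · have haway : ∀ w : IsDedekindDomain.HeightOneSpectrum (NumberField.RingOfIntegers K),
          ((ℓ : ℕ) : NumberField.RingOfIntegers K) ∉ w.asIdeal → ρ.IsUnramifiedAt w :=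
        fun w hw => Classical.by_contradiction fun hr => hram ⟨w, hw, hr⟩
      rcases Nat.eq_zero_or_pos k with rfl | hk
      · refine hZ hW hL ℓ (fun h => h02 ⟨rfl, h⟩) ?_ K n hcpt hn ι ρ hirr hgeo hcrys haway
        intro ℓ' _ hlt K' _ _ n' hcpt' hn' ι' ρ' hirr' hgeo' haway'
        exact hIH 0 ℓ' (Or.inr ⟨rfl, hlt⟩) K' n' hcpt' hn' ι' ρ' hirr' hgeo' ⟨∅, by simp, fun v _ hv => haway' v hv⟩
      · exact hIH 0 ℓ (Or.inl hk) K n hcpt hn ι ρ hirr hgeo ⟨∅, by simp, fun v _ hv => haway v hv⟩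
  · -- not lift-minimal: the level move
    push Not at hmin
    obtain ⟨w, hwℓ, hram, τ, hτ, htriv⟩ := hmin
    exact hN K n hcpt hn ι ρ hirr hgeo hcrys hlev ⟨w, hwℓ, hram, τ, hτ, htriv⟩

end Summit.Langlands.Langlands.Theorems
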